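import Literature.NumberTheory.Sieve.Maynard2016Prop92EDiffKernel
import Literature.NumberTheory.Sieve.Maynard2016Prop92YSqSum
import Literature.NumberTheory.Sieve.FGKMT2018Prop91Assembly
import Literature.NumberTheory.Sieve.Maynard2016Prop92Error
import Literature.NumberTheory.Sieve.Maynard2016Prop92Regroup
import HarnessLib

/-!
# Maynard 2016, Prop. 9.2 (`𝒜 = ℤ`): the error `E_diff^{(m)} ≪ (log X)^{−1/10} · main term` (leaf M3)

Source: J. Maynard, *Dense clusters of primes in subsets*, Compositio Math. 152 (2016) 1517–1554 =
arXiv:1405.2593v3 [Maynard2016DenseClusters], proof of Proposition 9.2 p. 22, (9.16)–(9.18) («the second term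
above contributes `≪ T_k²/(k log R) Σ_A … Σ_{r'} Y_{r'}² φ(r')/φ_ω(r')² ≪ … = o((log x)^{−1/10})` times the
main term, by Lemma 8.4»), Lemma 8.4 p. 16, Lemma 8.6 p. 18, Lemma 9.3 p. 21; K. Ford, B. Green,
S. Konyagin, J. Maynard, T. Tao, *Long gaps between primes*, J. Amer. Math. Soc. 31 (2018) 65–105
[FordGreenKonyaginMaynardTao2018], Theorem 6 (7.13).

This file closes the leaf `Maynard2016Prop92EDiffBound` (M3 of `Maynard2016Prop92MainDecomposition`) from
the leaf M2 (`Maynard2016Lemma93Z`, Lemma 9.3 in the frame).  By `abs_ediffM_le_of_approx`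
(`Maynard2016Prop92EDiffKernel`) it remains to bound ONE `(k−1)`-fold sum
`Σ_{r∈𝒟'} (∫F₂(u(r);t_m)dt_m)² w(∏r)`, `w(N) = ∏_{q∣N}(q+k−2)/φ_ω(N)²`: §1 writes it as an `rFoldSum` over the
moduli `W'_j` with the Prop-9.1 multiplicative function `A_w(p) = (p − ω(p))²/(p + k − 2)` (`1/∏_{p∣N}A_w(p) = w(N)`)
and the majorant `mixG²` at scale `R²` (as `sum_margInt_F₂_sq_le_rFoldSum`); §2 compares the Euler products
`Π_w ≤ 4¹² Π` for the `(k−1)` moduli `W'_j`; §3 is growth bookkeeping; §4 applies Lemma 8.4, identifies `Π` with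
the main term (`prop92_piRecM_eventually`) and combines with the kernel bound.

Final statements: `maynard2016Prop92EDiffBound_of_lemma93Z : Maynard2016Lemma93Z → Maynard2016Prop92EDiffBound`;
with Lemma 9.3 proved in the tree (`maynard2016Lemma93Z_holds`) the leaves M3, M4 hold unconditionally and, with
M1 (`maynard2016Prop92Regroup_holds`), the error half (`maynard2016Prop92ErrorPart_holds`) and the two proved
assemblies, **`maynard2016DenseClusters_prop92Z_holds : Maynard2016DenseClusters_prop92Z`** — Proposition 9.2
for `𝒜 = ℤ` in the frame of [FordGreenKonyaginMaynardTao2018] Theorem 6 (7.13).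
-/

noncomputable section

open Finset Real MeasureTheory Filter

namespace Literature.NumberTheory.Sieve.FGKMT2018

variable {n : ℕ}

/-! ### §1 The `F₂`-sum with the weight `w` as an `r`-fold sum for `A_w` -/

/-- **The Lemma-8.4 weight for `A_w` and the moduli `W'_j` is `1_{𝒟'}·w`**: for `s` in the box,
`rWeight n W' A_w s = 1_{(s;1) ∈ 𝒟'} · ∏_{q∣∏s}(q+k−2)/φ_ω(∏s)²`.
[cite: Maynard2016DenseClusters, proof of Prop. 9.2 p. 22 ((9.18): «by Lemma 8.4»); proof of Prop. 9.1 p. 20] -/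
theorem rWeight_idxModM_awFun_eq {L : Fin (n + 1) → ℤ × ℤ} {B : ℕ} {R : ℝ} {m : Fin (n + 1)}
    {s : Fin n → ℕ} (hR : 1 ≤ ⌊R⌋₊) (hs : s ∈ Fintype.piFinset fun _ : Fin n => Finset.Icc 1 ⌊R⌋₊) :
    MaynardDense.rWeight n (idxModM L B R m) (awFun L) s =
      if Fin.insertNth m 1 s ∈ dkBoxP L B R m then wRatio L (∏ j, s j) else 0 := by
  classical
  unfold MaynardDense.rWeight
  by_cases h : Fin.insertNth m 1 s ∈ dkBoxP L B R m
  · rw [if_pos ((insertNth_mem_dkBoxP_iff hR hs).1 h), if_pos h, wRatio, phiOmega, ← Finset.prod_pow,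
      ← Finset.prod_div_distrib, ← Finset.prod_inv_distrib]
    refine Finset.prod_congr rfl fun p _ => ?_
    rw [awFun, inv_div]
  · rw [if_neg (fun h' => h ((insertNth_mem_dkBoxP_iff hR hs).2 h')), if_neg h]

set_option maxHeartbeats 400000 in
/-- **The `F₂`-sum with weight `w` is dominated by an `r`-fold sum for `A_w` at scale `R²`** (`k = n + 1 ≥ 2`,
`R > 1`, admissible `𝓛`): `Σ_{r∈𝒟'} (∫F₂(u(r);t_m)dt_m)² w(∏r) ≤ (ℓ₂ + kℓ)² · rFoldSum_n(W', A_w, 1, mixG², R²)`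
(the fibre integral bounded by `(ℓ₂ + kℓ)∏_{j≠m} mixG(u_j/2)`, `u_j/2 = log s_j/log R²`, the box enlarged).
[cite: Maynard2016DenseClusters, proof of Prop. 9.2 p. 22, (9.18) and (9.20); Lemma 8.4 (8.9); Lemma 8.6] -/
theorem sum_margInt_F₂_sq_wRatio_le_rFoldSum (hn : 2 ≤ n + 1) {L : Fin (n + 1) → ℤ × ℤ}
    (hadm : FormsAdmissible L) (B : ℕ) {R : ℝ} (hR : 1 < R) (m : Fin (n + 1)) :
    ∑ r ∈ dkBoxP L B R m, margInt m (MaynardDense.F₂ (n + 1)) (logVec R r) ^ 2 * wRatio L (∏ i, r i) ≤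
      (MaynardDense.ell₂ (n + 1) + (n + 1 : ℕ) * MaynardDense.ell (n + 1)) ^ 2 *
        MaynardDense.rFoldSum n (idxModM L B R m) (awFun L)
          (fun _ => 1) (fun t => MaynardDense.mixG (n + 1) t ^ 2) (R ^ 2) 0 := by
  classical
  have hk1 : 1 ≤ n + 1 := le_trans (by norm_num) hn
  have hR1 : 1 ≤ ⌊R⌋₊ := Nat.one_le_iff_ne_zero.2 (Nat.pos_iff_ne_zero.1 (Nat.floor_pos.2 hR.le))
  have hR2 : 1 < R ^ 2 := by nlinarith
  have hlogR : 0 < Real.log R := Real.log_pos hR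
  set cF : ℝ := MaynardDense.ell₂ (n + 1) + (n + 1 : ℕ) * MaynardDense.ell (n + 1) with hcF
  set W' := idxModM L B R m with hW'
  set A : ℕ → ℝ := awFun L with hA
  have hG1 : ∀ t : ℝ, 1 ≤ t → MaynardDense.mixG (n + 1) t ^ 2 = 0 := fun t ht => by
    rw [MaynardDense.mixG_eq_zero hn ht]; ring
  rw [← MaynardDense.sum_piFinset_Icc_eq_rFoldSum n W' A (fun _ => (1 : ℝ)) hG1 hR2 0, Finset.mul_sum,
    sum_dkBoxP_eq_sum_insertNth]
  have hsub : (Fintype.piFinset fun _ : Fin n => Finset.Icc 1 ⌊R⌋₊).filter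
      (fun s => Fin.insertNth m 1 s ∈ dkBoxP L B R m) ⊆
      Fintype.piFinset fun _ : Fin n => Finset.Icc 1 ⌊R ^ 2⌋₊ := by
    intro s hs
    have hs' := Fintype.mem_piFinset.1 (Finset.mem_filter.1 hs).1
    rw [Fintype.mem_piFinset]
    intro j
    have h := Finset.mem_Icc.1 (hs' j)
    exact Finset.mem_Icc.2 ⟨h.1, h.2.trans (Nat.floor_le_floor (by nlinarith))⟩
  have huR : ∀ e : ℕ, MaynardDense.uOf (R ^ 2) e = MaynardDense.uOf R e / 2 := fun e => by
    simp only [MaynardDense.uOf, Real.log_pow]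
    push_cast
    field_simp
  have hpt : ∀ s ∈ (Fintype.piFinset fun _ : Fin n => Finset.Icc 1 ⌊R⌋₊).filter
      (fun s => Fin.insertNth m 1 s ∈ dkBoxP L B R m),
      margInt m (MaynardDense.F₂ (n + 1)) (logVec R (Fin.insertNth m 1 s)) ^ 2 *
          wRatio L (∏ i, (Fin.insertNth m 1 s : Fin (n + 1) → ℕ) i) ≤
        cF ^ 2 * (MaynardDense.rWeight n W' A s *
          ((fun _ : ℝ => (1 : ℝ)) (0 + ∑ j, MaynardDense.uOf (R ^ 2) (s j)) *
            ∏ j, (fun t => MaynardDense.mixG (n + 1) t ^ 2) (MaynardDense.uOf (R ^ 2) (s j)))) := by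
    intro s hs
    obtain ⟨hsb, hmem⟩ := Finset.mem_filter.1 hs
    have hs1 : ∀ j, 1 ≤ s j := fun j => (Finset.mem_Icc.1 (Fintype.mem_piFinset.1 hsb j)).1
    rw [hW', hA, rWeight_idxModM_awFun_eq hR1 hsb, if_pos hmem, prod_insertNth_one]
    simp only [one_mul, huR]
    obtain ⟨h0, hle⟩ := margInt_F₂_insertNth_le hn m hR hs1
    have hw : 0 ≤ wRatio L (∏ j, s j) := wRatio_nonneg hk1 L _
    calc margInt m (MaynardDense.F₂ (n + 1)) (logVec R (Fin.insertNth m 1 s)) ^ 2 * wRatio L (∏ j, s j)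
        ≤ (cF * ∏ j, MaynardDense.mixG (n + 1) (MaynardDense.uOf R (s j) / 2)) ^ 2 *
            wRatio L (∏ j, s j) :=
          mul_le_mul_of_nonneg_right (pow_le_pow_left₀ h0 hle 2) hw
      _ = _ := by rw [mul_pow, Finset.prod_pow]; ring
  have hnn : ∀ s ∈ (Fintype.piFinset fun _ : Fin n => Finset.Icc 1 ⌊R ^ 2⌋₊),
      s ∉ (Fintype.piFinset fun _ : Fin n => Finset.Icc 1 ⌊R⌋₊).filter
        (fun s => Fin.insertNth m 1 s ∈ dkBoxP L B R m) →
      0 ≤ cF ^ 2 * (MaynardDense.rWeight n W' A s *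
          ((fun _ : ℝ => (1 : ℝ)) (0 + ∑ j, MaynardDense.uOf (R ^ 2) (s j)) *
            ∏ j, (fun t => MaynardDense.mixG (n + 1) t ^ 2) (MaynardDense.uOf (R ^ 2) (s j)))) := by
    intro s _ _
    simp only [one_mul]
    exact mul_nonneg (sq_nonneg _) (mul_nonneg
      (MaynardDense.rWeight_nonneg _ (fun _ hp => awFun_pos hn hadm hp) s)
      (Finset.prod_nonneg fun j _ => sq_nonneg _))
  exact (Finset.sum_le_sum hpt).trans (Finset.sum_le_sum_of_subset_of_nonneg hsub hnn)

/-! ### §2 `Π_w ≤ 4¹² Π` for the moduli `W'_j` -/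

set_option maxHeartbeats 400000 in
/-- **The partial Euler products compare** (moduli `W'_j`, `j ≠ m`, `k = n + 1`):
`∏_{p<y}(1 + n'(p)/A_w(p))(1 − 1/p)^{k−1} ≤ 4¹² ∏_{p<y}(1 + n'(p)/(p − ω(p)))(1 − 1/p)^{k−1}`
(`n'(p) = 0` for `p ≤ 2k²` as `p ∣ W ∣ W'_j`; `1 + n/A_w ≤ (1 + 8k²/p²)(1 + n/(p − ω))`; `∏(1 + 8k²/p²) ≤ 4¹²`).
[cite: Maynard2016DenseClusters, Lemma 8.4 (definition of Π_g), proof of Prop. 9.2 p. 22 and of Prop. 9.1 p. 20] -/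
theorem piPartial_awFun_le_M (hk : 2 ≤ n + 1) {L : Fin (n + 1) → ℤ × ℤ} (hadm : FormsAdmissible L)
    (B : ℕ) (R : ℝ) (m : Fin (n + 1)) (y : ℕ) :
    MaynardDense.piPartial n (idxModM L B R m) (awFun L) y ≤
      (4 : ℝ) ^ 12 * MaynardDense.piPartial n (idxModM L B R m) (fun p => (p : ℝ) - omegaL L p) y := by
  classical
  unfold MaynardDense.piPartial
  set W := idxModM L B R m with hW
  set c : ℕ → ℝ := fun p =>
    if 2 * (n + 1) ^ 2 < p then 1 + 8 * ((n + 1 : ℕ) : ℝ) ^ 2 / (p : ℝ) ^ 2 else 1 with hc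
  have hc1 : ∀ p, 1 ≤ c p := fun p => by
    by_cases h : 2 * (n + 1) ^ 2 < p
    · rw [show c p = 1 + 8 * ((n + 1 : ℕ) : ℝ) ^ 2 / (p : ℝ) ^ 2 from if_pos h]
      have : 0 ≤ 8 * ((n + 1 : ℕ) : ℝ) ^ 2 / (p : ℝ) ^ 2 := by positivity
      linarith
    · rw [show c p = 1 from if_neg h]
  have hfac0 : ∀ p ∈ Nat.primesBelow y, 0 ≤ (1 - 1 / (p : ℝ)) ^ n := fun p hp => by
    have hpp : p.Prime := (Nat.mem_primesBelow.1 hp).2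
    have hp1 : (1 : ℝ) ≤ p := by exact_mod_cast hpp.one_lt.le
    exact pow_nonneg (by rw [sub_nonneg, div_le_one (by linarith)]; exact hp1) n
  have hterm : ∀ p ∈ Nat.primesBelow y,
      (1 + (MaynardDense.nW n W p : ℝ) / awFun L p) * (1 - 1 / (p : ℝ)) ^ n ≤
        c p * ((1 + (MaynardDense.nW n W p : ℝ) / ((p : ℝ) - omegaL L p)) * (1 - 1 / (p : ℝ)) ^ n) := by
    intro p hp
    have hpp : p.Prime := (Nat.mem_primesBelow.1 hp).2
    have hq := hfac0 p hp
    by_cases h2k : 2 * (n + 1) ^ 2 < p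
    · rw [show c p = 1 + 8 * ((n + 1 : ℕ) : ℝ) ^ 2 / (p : ℝ) ^ 2 from if_pos h2k]
      have hn0 : (0 : ℝ) ≤ MaynardDense.nW n W p := Nat.cast_nonneg _
      have hnk : (MaynardDense.nW n W p : ℝ) ≤ ((n + 1 : ℕ) : ℝ) := by
        have h1 : MaynardDense.nW n W p ≤ n := nW_le W p
        have h2 : (MaynardDense.nW n W p : ℝ) ≤ n := by exact_mod_cast h1
        push_cast; linarith
      have h := one_add_div_awFun_le hk hadm hpp h2k hn0 hnk
      calc (1 + (MaynardDense.nW n W p : ℝ) / awFun L p) * (1 - 1 / (p : ℝ)) ^ n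
          ≤ ((1 + 8 * ((n + 1 : ℕ) : ℝ) ^ 2 / (p : ℝ) ^ 2) *
              (1 + (MaynardDense.nW n W p : ℝ) / ((p : ℝ) - omegaL L p))) * (1 - 1 / (p : ℝ)) ^ n :=
            mul_le_mul_of_nonneg_right h hq
        _ = _ := by ring
    · rw [not_lt] at h2k
      have hn : MaynardDense.nW n W p = 0 := by
        unfold MaynardDense.nW
        exact Finset.sum_eq_zero fun i _ => if_pos (hW ▸ dvd_idxModM_of_le L B R m i hpp h2k)
      rw [show c p = 1 from if_neg (not_lt.2 h2k), hn]
      simp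
  have hnonneg : ∀ p ∈ Nat.primesBelow y,
      0 ≤ (1 + (MaynardDense.nW n W p : ℝ) / awFun L p) * (1 - 1 / (p : ℝ)) ^ n := fun p hp =>
    mul_nonneg (add_nonneg zero_le_one (div_nonneg (Nat.cast_nonneg _) (awFun_nonneg hk L p))) (hfac0 p hp)
  have hnonneg' : ∀ p ∈ Nat.primesBelow y,
      0 ≤ (1 + (MaynardDense.nW n W p : ℝ) / ((p : ℝ) - omegaL L p)) * (1 - 1 / (p : ℝ)) ^ n := fun p hp =>
    mul_nonneg (add_nonneg zero_le_one (div_nonneg (Nat.cast_nonneg _)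
      (sub_omegaL_pos hadm (Nat.mem_primesBelow.1 hp).2).le)) (hfac0 p hp)
  have hcprod : ∏ p ∈ Nat.primesBelow y, c p ≤ (4 : ℝ) ^ 12 := by
    have h1 : ∀ p ∈ Nat.primesBelow y,
        c p ≤ Real.exp (if 2 * (n + 1) ^ 2 < p then 8 * ((n + 1 : ℕ) : ℝ) ^ 2 / (p : ℝ) ^ 2 else 0) := by
      intro p _
      by_cases h : 2 * (n + 1) ^ 2 < p
      · rw [show c p = 1 + 8 * ((n + 1 : ℕ) : ℝ) ^ 2 / (p : ℝ) ^ 2 from if_pos h, if_pos h]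
        have := Real.add_one_le_exp (8 * ((n + 1 : ℕ) : ℝ) ^ 2 / (p : ℝ) ^ 2)
        linarith
      · rw [show c p = 1 from if_neg h, if_neg h, Real.exp_zero]
    have h12 : (12 : ℝ) * Real.log 4 = Real.log ((4 : ℝ) ^ 12) := by
      rw [Real.log_pow]; norm_num
    calc ∏ p ∈ Nat.primesBelow y, c p
        ≤ ∏ p ∈ Nat.primesBelow y,
            Real.exp (if 2 * (n + 1) ^ 2 < p then 8 * ((n + 1 : ℕ) : ℝ) ^ 2 / (p : ℝ) ^ 2 else 0) :=
          Finset.prod_le_prod (fun p _ => zero_le_one.trans (hc1 p)) h1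
      _ = Real.exp (∑ p ∈ Nat.primesBelow y,
            if 2 * (n + 1) ^ 2 < p then 8 * ((n + 1 : ℕ) : ℝ) ^ 2 / (p : ℝ) ^ 2 else 0) := by
          rw [Real.exp_sum]
      _ ≤ Real.exp (12 * Real.log 4) := Real.exp_le_exp.2 (sum_ite_div_sq_le hk y)
      _ = (4 : ℝ) ^ 12 := by rw [h12, Real.exp_log (by positivity)]
  calc ∏ p ∈ Nat.primesBelow y, (1 + (MaynardDense.nW n W p : ℝ) / awFun L p) * (1 - 1 / (p : ℝ)) ^ n
      ≤ ∏ p ∈ Nat.primesBelow y,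
          (c p * ((1 + (MaynardDense.nW n W p : ℝ) / ((p : ℝ) - omegaL L p)) * (1 - 1 / (p : ℝ)) ^ n)) :=
        Finset.prod_le_prod hnonneg hterm
    _ = (∏ p ∈ Nat.primesBelow y, c p) *
          ∏ p ∈ Nat.primesBelow y, ((1 + (MaynardDense.nW n W p : ℝ) / ((p : ℝ) - omegaL L p)) *
            (1 - 1 / (p : ℝ)) ^ n) := Finset.prod_mul_distrib
    _ ≤ (4 : ℝ) ^ 12 * ∏ p ∈ Nat.primesBelow y,
          ((1 + (MaynardDense.nW n W p : ℝ) / ((p : ℝ) - omegaL L p)) * (1 - 1 / (p : ℝ)) ^ n) :=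
        mul_le_mul_of_nonneg_right hcprod (Finset.prod_nonneg hnonneg')

/-- **`Π_w ≤ 4¹² Π` for the moduli `W'_j`** (`k = n + 1 ≥ 4`, admissible non-degenerate `𝓛`, `B ≠ 0`): both
constants are limits of their partial Euler products (`tendsto_piPartial_dec`).
[cite: Maynard2016DenseClusters, Lemma 8.4 (Π_g), proof of Prop. 9.2 p. 22 ((9.18) «by Lemma 8.4») and of Prop. 9.1 p. 20] -/
theorem piRec_awFun_le_M (h4 : 4 ≤ n + 1) {L : Fin (n + 1) → ℤ × ℤ} (hadm : FormsAdmissible L)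
    (hnd : FormsNondegenerate L) {B : ℕ} (hB : B ≠ 0) (R : ℝ) (m : Fin (n + 1)) :
    MaynardDense.piRec n (idxModM L B R m) (awFun L) ≤
      (4 : ℝ) ^ 12 * MaynardDense.piRec n (idxModM L B R m) (fun p => (p : ℝ) - omegaL L p) := by
  have hk2 : 2 ≤ n + 1 := le_trans (by norm_num) h4
  have hkr2 : (2 : ℝ) ≤ ((n + 1 : ℕ) : ℝ) := by exact_mod_cast hk2
  have hnr : (n : ℝ) ≤ ((n + 1 : ℕ) : ℝ) := by push_cast; linarith
  have hW0 : ∀ i, idxModM L B R m i ≠ 0 := fun i => idxModM_ne_zero hnd hB R m i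
  have hsm : ∀ i, ∀ p : ℕ, p.Prime → (p : ℝ) ≤ 2 * ((n + 1 : ℕ) : ℝ) ^ 2 → p ∣ idxModM L B R m i :=
    fun i p hp hle => dvd_idxModM_of_le L B R m i hp (by exact_mod_cast hle)
  have hT1 := MaynardDense.tendsto_piPartial_dec n (idxModM L B R m) ((n + 1 : ℕ) : ℝ)
    (((n + 1 : ℕ) : ℝ) ^ 2) (awFun L) hkr2 le_rfl hW0 hsm (fun p hp => awFun_pos hk2 hadm hp)
    (fun p hp => by
      have h := abs_one_add_awFun_sub_le h4 hadm hp
      linarith)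
  have hT2 := MaynardDense.tendsto_piPartial_dec n (idxModM L B R m) ((n + 1 : ℕ) : ℝ)
    (2 * ((n + 1 : ℕ) : ℝ) - 1) (fun p => (p : ℝ) - omegaL L p) hkr2
    (by nlinarith [sq_nonneg (((n + 1 : ℕ) : ℝ) - 1)]) hW0 hsm (fun p hp => sub_omegaL_pos hadm hp)
    (fun p hp => abs_dev_omegaL_add_pred_le hadm hp)
  exact le_of_tendsto_of_tendsto' hT1 (hT2.const_mul _) fun y => piPartial_awFun_le_M hk2 hadm B R m y

/-! ### §3 Growth bookkeeping -/

set_option maxHeartbeats 400000 in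
/-- In the ranges of Prop. 6.1, eventually `k² T_k/log R ≤ 60 (log X)^{−1/10}` («we recall `k ≤ (log x)^{1/5}`
and `T_k = k log k`»). [cite: Maynard2016DenseClusters, proof of Prop. 9.2 p. 23 (the errors are o((log x)^{-1/10}))] -/
theorem eventually_prop92_growth' :
    ∀ᶠ x : ℕ in atTop, ∀ k : ℕ, (k : ℝ) ≤ Real.log x ^ ((1 : ℝ) / 5) → ∀ X R : ℝ,
      (x : ℝ) / 2 ≤ X → X ≤ x * Real.log x ^ 2 → X ^ ((1 : ℝ) / 30) ≤ R → R ≤ X ^ ((1 : ℝ) / 9) →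
        (k : ℝ) ^ 2 * MaynardDense.T k / Real.log R ≤ 60 / Real.log X ^ ((1 : ℝ) / 10) := by
  filter_upwards [eventually_prop91_main_aux 2, eventually_excProd_aux] with x hx hx' k hk X R hX1 hX2
    hR1 hR2
  obtain ⟨hXone, hlX1, h2u, -, -, hlogXR, hR2'⟩ := hx k hk X R hX1 hR1
  obtain ⟨-, hℓX, -, -, -⟩ := hx' k hk X R hX1 hX2 hR1
  set lX := Real.log X with hlX
  set u := lX ^ ((1 : ℝ) / 10) with hu
  have hlX0 : 0 < lX := by linarith
  have hu0 : 0 < u := by rw [hu]; positivity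
  have hu1 : 1 ≤ u := by linarith
  have hlR0 : 0 < Real.log R := by linarith
  have hk0 : (0 : ℝ) ≤ k := Nat.cast_nonneg k
  have hT : MaynardDense.T k ≤ (k : ℝ) ^ 2 := by
    have := Real.log_le_self hk0
    show (k : ℝ) * Real.log k ≤ (k : ℝ) ^ 2
    nlinarith
  set ℓ := Real.log (x : ℝ) with hℓ
  have hℓ0 : 0 ≤ ℓ := Real.log_natCast_nonneg x
  have hk4 : (k : ℝ) ^ 4 ≤ ℓ ^ ((4 : ℝ) / 5) := by
    have h := pow_le_pow_left₀ hk0 hk 4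
    rw [← Real.rpow_natCast (ℓ ^ ((1 : ℝ) / 5)) 4, ← Real.rpow_mul hℓ0] at h
    norm_num at h; exact h
  have h45 : ℓ ^ ((4 : ℝ) / 5) ≤ 2 * lX ^ ((4 : ℝ) / 5) := by
    calc ℓ ^ ((4 : ℝ) / 5) ≤ (2 * lX) ^ ((4 : ℝ) / 5) := Real.rpow_le_rpow hℓ0 hℓX (by norm_num)
      _ = (2 : ℝ) ^ ((4 : ℝ) / 5) * lX ^ ((4 : ℝ) / 5) := Real.mul_rpow (by norm_num) hlX0.le
      _ ≤ 2 * lX ^ ((4 : ℝ) / 5) :=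
          mul_le_mul_of_nonneg_right (Real.rpow_le_self_of_one_le (by norm_num) (by norm_num))
            (by positivity)
  have hk2T : (k : ℝ) ^ 2 * MaynardDense.T k ≤ 2 * lX ^ ((4 : ℝ) / 5) := by
    calc (k : ℝ) ^ 2 * MaynardDense.T k ≤ (k : ℝ) ^ 2 * (k : ℝ) ^ 2 :=
          mul_le_mul_of_nonneg_left hT (sq_nonneg _)
      _ = (k : ℝ) ^ 4 := by ring
      _ ≤ 2 * lX ^ ((4 : ℝ) / 5) := hk4.trans h45
  have key : lX ^ ((4 : ℝ) / 5) * u = lX / u := by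
    rw [eq_div_iff hu0.ne', hu, ← Real.rpow_add hlX0, ← Real.rpow_add hlX0]
    norm_num
  have key' : lX ^ ((4 : ℝ) / 5) = lX / u / u := by
    rw [← key]; field_simp
  rw [div_le_iff₀ hlR0]
  calc (k : ℝ) ^ 2 * MaynardDense.T k ≤ 2 * lX ^ ((4 : ℝ) / 5) := hk2T
    _ = 2 * (lX / u / u) := by rw [key']
    _ ≤ 2 * (30 * Real.log R / u / u) := by
        refine mul_le_mul_of_nonneg_left (div_le_div_of_nonneg_right
          (div_le_div_of_nonneg_right hlogXR hu0.le) hu0.le) (by norm_num)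
    _ = 60 / u * Real.log R / u := by ring
    _ ≤ 60 / u * Real.log R := div_le_self (by positivity) hu1

/-- `log 4 ≤ 2`. [folklore] -/
private theorem log_four_le_two''' : Real.log 4 ≤ 2 := by
  have h := Real.exp_one_gt_d9
  have he2 : Real.exp 2 = Real.exp 1 * Real.exp 1 := by rw [← Real.exp_add]; norm_num
  rw [Real.log_le_iff_le_exp (by norm_num), he2]
  nlinarith

set_option maxHeartbeats 400000 in
/-- The final real bookkeeping of (9.16)–(9.18): from `|E| ≤ 2c²(1/κ + δ)(C_s·6log4/log R + δ)·S_w`,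
`c² S_w ≤ Θ κ² · M c_x`, `C_s ≤ 3T`, `κ²T/log R ≤ 60/u`, `δκ² ≤ 24000K/u`, `|c_x − 1| ≤ 1/u`, `u ≥ 1`:
`|E| ≤ 4Θ(2160 + 51864000K + (24000K)²)/u · M`.
[cite: Maynard2016DenseClusters, proof of Prop. 9.2 pp. 22–23 ((9.18) is o((log x)^{-1/10}) times the main term)] -/
theorem ediff_final_combination {E Sw M cx u c2 κ δ T lR Cs K Θ : ℝ} (hM : 0 ≤ M) (hu : 1 ≤ u)
    (hc : |cx - 1| ≤ 1 / u) (hκ : 1 ≤ κ) (hδ : 0 ≤ δ) (hT : 0 ≤ T) (hlR : 0 < lR) (hCs0 : 0 ≤ Cs)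
    (hCs : Cs ≤ 3 * T) (hΘ : 0 ≤ Θ) (hK : 0 ≤ K) (hSw0 : 0 ≤ c2 * Sw)
    (hE : |E| ≤ 2 * (c2 * (1 / κ + δ)) * (Cs * (6 * Real.log 4) / lR + δ) * Sw)
    (hSw : c2 * Sw ≤ Θ * κ ^ 2 * (M * cx))
    (hg1 : κ ^ 2 * T / lR ≤ 60 / u) (hg2 : δ * κ ^ 2 ≤ 24000 * K / u) :
    |E| ≤ 4 * Θ * (2160 + 51864000 * K + (24000 * K) ^ 2) / u * M := by
  have hu0 : 0 < u := by linarith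
  have hκ0 : 0 < κ := by linarith
  have hc1 : cx ≤ 2 := by
    have := (abs_le.1 hc).2
    have : 1 / u ≤ 1 := by rw [div_le_one hu0]; exact hu
    linarith
  have hc0 : 0 ≤ cx := by
    have := (abs_le.1 hc).1
    have : 1 / u ≤ 1 := by rw [div_le_one hu0]; exact hu
    linarith
  have hMc : M * cx ≤ 2 * M := by nlinarith
  have hMc0 : 0 ≤ M * cx := mul_nonneg hM hc0
  have hlog4 := log_four_le_two'''
  have hlog40 : 0 ≤ Real.log 4 := Real.log_nonneg (by norm_num)
  -- the bracket `(C_s 6 log 4/log R + δ) ≤ 36 T/log R + δ`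
  have hbr : Cs * (6 * Real.log 4) / lR + δ ≤ 36 * T / lR + δ := by
    have h1 : Cs * (6 * Real.log 4) ≤ 36 * T := by nlinarith
    have := div_le_div_of_nonneg_right h1 hlR.le
    linarith
  have hbr0 : 0 ≤ Cs * (6 * Real.log 4) / lR + δ := by positivity
  have hα0 : 0 ≤ 1 / κ + δ := by positivity
  -- `(1/κ + δ)κ²(36T/log R + δ) ≤ K'/u`
  set a := κ ^ 2 * T / lR with ha
  set b := δ * κ ^ 2 with hb
  have ha0 : 0 ≤ a := by positivity
  have hb0 : 0 ≤ b := by positivity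
  have hTl0 : 0 ≤ T / lR := by positivity
  have h1 : κ * T / lR ≤ a := by
    rw [ha]
    refine div_le_div_of_nonneg_right ?_ hlR.le
    have h0 : 0 ≤ κ * T * (κ - 1) := mul_nonneg (mul_nonneg hκ0.le hT) (by linarith)
    have e : κ ^ 2 * T = κ * T + κ * T * (κ - 1) := by ring
    linarith
  have h2 : κ * δ ≤ b := by rw [hb]; nlinarith
  have h3 : b * (T / lR) ≤ 24000 * K * 60 / u := by
    have e1 : T / lR = a / κ ^ 2 := by rw [ha]; field_simp
    have e2 : a / κ ^ 2 ≤ a := div_le_self ha0 (one_le_pow₀ hκ)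
    have e3 : a ≤ 60 := hg1.trans (div_le_self (by norm_num) hu)
    calc b * (T / lR) ≤ (24000 * K / u) * 60 := by
          rw [e1]; exact mul_le_mul hg2 (e2.trans e3) (by positivity) (by positivity)
      _ = 24000 * K * 60 / u := by ring
  have h4 : δ * b ≤ (24000 * K) ^ 2 / u := by
    have e1 : δ * b = b ^ 2 / κ ^ 2 := by rw [hb]; field_simp
    have e2 : b ^ 2 / κ ^ 2 ≤ b ^ 2 := div_le_self (sq_nonneg _) (one_le_pow₀ hκ)
    have e3 : b ^ 2 ≤ (24000 * K / u) ^ 2 := pow_le_pow_left₀ hb0 hg2 2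
    have e4 : (24000 * K / u) ^ 2 ≤ (24000 * K) ^ 2 / u := by
      rw [div_pow]
      exact div_le_div_of_nonneg_left (sq_nonneg _) hu0 (by nlinarith)
    linarith
  have hprod : (1 / κ + δ) * κ ^ 2 * (36 * T / lR + δ) ≤
      (2160 + 51864000 * K + (24000 * K) ^ 2) / u := by
    have e : (1 / κ + δ) * κ ^ 2 * (36 * T / lR + δ) =
        36 * (κ * T / lR) + κ * δ + 36 * (b * (T / lR)) + δ * b := by
      rw [hb]; field_simp; ring
    rw [e]
    have ha' : κ * T / lR ≤ 60 / u := h1.trans hg1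
    have hb' : κ * δ ≤ 24000 * K / u := h2.trans hg2
    have : 36 * (60 / u) + 24000 * K / u + 36 * (24000 * K * 60 / u) + (24000 * K) ^ 2 / u =
        (2160 + 51864000 * K + (24000 * K) ^ 2) / u := by ring
    linarith
  -- combine
  calc |E| ≤ 2 * (c2 * (1 / κ + δ)) * (Cs * (6 * Real.log 4) / lR + δ) * Sw := hE
    _ = 2 * (1 / κ + δ) * (Cs * (6 * Real.log 4) / lR + δ) * (c2 * Sw) := by ring
    _ ≤ 2 * (1 / κ + δ) * (36 * T / lR + δ) * (Θ * κ ^ 2 * (M * cx)) :=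
        mul_le_mul (mul_le_mul_of_nonneg_left hbr (by positivity)) hSw hSw0 (by positivity)
    _ = 2 * Θ * ((1 / κ + δ) * κ ^ 2 * (36 * T / lR + δ)) * (M * cx) := by ring
    _ ≤ 2 * Θ * ((2160 + 51864000 * K + (24000 * K) ^ 2) / u) * (2 * M) :=
        mul_le_mul (mul_le_mul_of_nonneg_left hprod (by positivity)) hMc hMc0 (by positivity)
    _ = 4 * Θ * (2160 + 51864000 * K + (24000 * K) ^ 2) / u * M := by ring

end Literature.NumberTheory.Sieve.FGKMT2018

namespace Literature.NumberTheory.Sieve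

open FGKMT2018

set_option maxHeartbeats 4000000 in
/-- **Maynard 2016, Proposition 9.2 (𝒜 = ℤ), (9.16)–(9.18)** — the DAG leaf M3 of
`Maynard2016Prop92MainDecomposition` from the leaf M2 (Lemma 9.3 in the frame of Prop. 6.1): for
`(a_m, B) = 1`, `E_diff^{(m)} = Σ'_{r,s} y_r^{(m)}(y_s^{(m)} − y_r^{(m)}) T^{(m)}_{r,s}/φ_ω(r)² ≪ (log X)^{−1/10} ·
(log R)^{k+1} W^{k−1}B^{k−1}𝔖_{WB}(𝓛)/φ(WB)^{k−1} · J_k · ∏_{p∣a_m, p∤WB}(p−1)/p`.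
Proof: the kernel bound `abs_ediffM_le_of_approx` (pointwise Lemma 9.3, marginal Lemma 8.2, the count of
the `s`, regrouping `r = A r'`) leaves `Σ_{r'} Y²_{r'} w(r')` with `Y_{r'} = ∫F₂ dt_m`; this is an `rFoldSum` for
`A_w` majorised at scale `R²` (`sum_margInt_F₂_sq_wRatio_le_rFoldSum`), evaluated by Lemma 8.4
(`lemma84_all'_dec`, `L(e) ≪ (log X)^{1/10}`), `Π_w ≤ 4¹²Π` (`piRec_awFun_le_M`), `(2∫mixG²)^{k−1} ≤ e⁴γ^{k−1}`,
`ℓ²γ^{k−1} ≤ 2J_k` (Lemma 8.6), and `c_m²(log R)²·Π·(log R)^{k−1}J = main term · (1 + O(1/log X))`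
(`prop92_piRecM_eventually`); the growth `k²T_k(log log R)²/log R, k²T_k/log R ≪ (log X)^{−1/10}`.
[cite: Maynard2016DenseClusters, Prop. 9.2 and its proof (9.14)–(9.18) p. 22; Lemma 9.3 p. 21;
Lemma 8.4 p. 16; Lemma 8.6 p. 18; Lemma 8.2 p. 15]
[cite: FordGreenKonyaginMaynardTao2018, Thm 6 (7.13) pp. 21–22] -/
theorem maynard2016Prop92EDiffBound_of_lemma93Z :
    Maynard2016Lemma93Z → Maynard2016Prop92EDiffBound := by
  rintro ⟨C₂, K₂, hK₂, h2⟩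
  obtain ⟨C84, hC84, h84⟩ := MaynardDense.lemma84_all'_dec
  refine ⟨max C₂ 262144,
    4 * (24 * 4 ^ 12 * Real.exp 4) * (2160 + 51864000 * K₂ + (24000 * K₂) ^ 2), by positivity, ?_⟩
  unfold Prop61Frame at h2 ⊢
  filter_upwards [h2, prop92_piRecM_eventually,
    eventually_prop91_main_aux (6960 * 186 * C84 + 2), eventually_prop92_growth,
    eventually_prop92_growth']
    with x hx2 hxB hx hxg hxg' B hB hBx k L X R hCk hk hadm hnd hcoef hX1 hX2 hR1 hR2 m hcop
  have hC₂k : C₂ ≤ k := le_trans (le_max_left _ _) hCk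
  have h18 : 262144 ≤ k := le_trans (le_max_right _ _) hCk
  obtain ⟨n, rfl⟩ : ∃ n, k = n + 1 := ⟨k - 1, by omega⟩
  have hk2 : 2 ≤ n + 1 := le_trans (by norm_num) h18
  have h4 : 4 ≤ n + 1 := le_trans (by norm_num) h18
  -- the inputs: Lemma 9.3 pointwise, the `Π'`-frame, the growth facts
  have hM2 := hx2 B hB hBx (n + 1) L X R hC₂k hk hadm hnd hcoef hX1 hX2 hR1 hR2 m hcop
  obtain ⟨hXone, hlX1, hK₀u, hk2X, hk3X, hlogXR, hR2'⟩ := hx (n + 1) hk X R hX1 hR1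
  obtain ⟨hlR1, hlRX, hgrowth⟩ := hxg (n + 1) hk X R hX1 hX2 hR1 hR2
  have hgrowth' := hxg' (n + 1) hk X R hX1 hX2 hR1 hR2
  obtain ⟨-, E, hE1, -, hlogE, hWi, hc1, hframe⟩ :=
    hxB B hB hBx n L X R hk2 hk hadm hnd hcoef hX1 hX2 hR1 hR2 m
  -- basic real facts
  have hB0 : B ≠ 0 := hB.elim (fun h => by rw [h]; exact one_ne_zero) fun h => h.ne_zero
  have hlX0 : 0 < Real.log X := by linarith
  have hlR0 : 0 < Real.log R := by linarith
  have hX0 : 0 < X := by linarith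
  have hR1' : 1 < R := by linarith
  have hR0 : 0 < R := by linarith
  have hRX : R ≤ X := hR2.trans (Real.rpow_le_self_of_one_le hXone (by norm_num))
  have hBX : (B : ℝ) ≤ 2 * X := by
    have : (B : ℝ) ≤ x := by exact_mod_cast hBx
    linarith
  have hkr2 : (2 : ℝ) ≤ ((n + 1 : ℕ) : ℝ) := by exact_mod_cast hk2
  have hkr1 : (1 : ℝ) ≤ ((n + 1 : ℕ) : ℝ) := by linarith
  have hnr : (n : ℝ) ≤ ((n + 1 : ℕ) : ℝ) := by push_cast; linarith
  have hn0 : (0 : ℝ) ≤ n := Nat.cast_nonneg n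
  set u : ℝ := Real.log X ^ ((1 : ℝ) / 10) with hu
  have hu1 : 1 ≤ u := Real.one_le_rpow hlX1 (by norm_num)
  have hu0 : 0 < u := by linarith
  have hulX : u ≤ Real.log X := Real.rpow_le_self_of_one_le hlX1 (by norm_num)
  have hCE₂0 : 0 ≤ 6960 * 186 * C84 := by positivity
  have huCE₂ : 6960 * 186 * C84 ≤ u := by linarith
  have hRsq2 : 2 ≤ R ^ 2 := by
    have h := mul_le_mul hR2' hR1'.le zero_le_one hR0.le
    rw [sq]; linarith
  have hRsqX : R ^ 2 ≤ X := by
    have h1 : R ^ 2 ≤ (X ^ ((1 : ℝ) / 9)) ^ 2 := pow_le_pow_left₀ hR0.le hR2 2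
    have h2 : (X ^ ((1 : ℝ) / 9)) ^ 2 = X ^ ((2 : ℝ) / 9) := by
      rw [← Real.rpow_natCast, ← Real.rpow_mul hX0.le]; norm_num
    rw [h2] at h1
    exact h1.trans (Real.rpow_le_self_of_one_le hXone (by norm_num))
  have hlogR2 : Real.log (R ^ 2) = 2 * Real.log R := by
    rw [Real.log_pow]; norm_num
  -- test-function constants (Lemma 8.6)
  have hγ := MaynardDense.gam_pos hk2
  have hℓ := MaynardDense.ell_pos hk2
  have hℓ₂ := MaynardDense.ell₂_nonneg hk2
  have hTk := MaynardDense.T_pos hk2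
  obtain ⟨hM1, hM2g, hM3, hM4, hM5⟩ := MaynardDense.lemma84_hypG_mixSq hk2
  have hJ2 : MaynardDense.ell (n + 1) ^ 2 * MaynardDense.gam (n + 1) ^ n ≤
      2 * MaynardDense.JF (n + 1) := by
    have h1 := MaynardDense.orthantJ_F_ge_half h18 (Fin.last n)
    rw [MaynardDense.orthantJ_F₁ n (Fin.last n)] at h1
    have h2 : MaynardDense.JF (n + 1) =
        MaynardDense.orthantJ n (Fin.last n) (MaynardDense.F (n + 1)) := by
      rw [MaynardDense.JF]
    rw [h2]; linarith
  have hJ0 : 0 ≤ MaynardDense.JF (n + 1) := by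
    have := mul_nonneg (sq_nonneg (MaynardDense.ell (n + 1))) (pow_nonneg hγ.le n)
    linarith
  have hIGγ := MaynardDense.half_gam_le_setIntegral_mixG_sq hk2
  set IG₂ : ℝ := ∫ t in Set.Ici (0 : ℝ), MaynardDense.mixG (n + 1) t ^ 2 with hIG₂
  have hIG₂0 : 0 < IG₂ := by linarith
  -- the moduli `W'_j` and the multiplicative functions `p − ω(p)`, `A_w`
  set W : Fin n → ℕ := idxModM L B R m with hW
  set A : ℕ → ℝ := fun p => (p : ℝ) - omegaL L p with hA
  have hW0 : ∀ i, W i ≠ 0 := fun i => idxModM_ne_zero hnd hB0 R m i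
  have hsm : ∀ i, ∀ p : ℕ, p.Prime → (p : ℝ) ≤ 2 * ((n + 1 : ℕ) : ℝ) ^ 2 → p ∣ W i :=
    fun i p hp hle => dvd_idxModM_of_le L B R m i hp (by exact_mod_cast hle)
  have hAwp : ∀ p : ℕ, p.Prime → 0 < awFun L p := fun p hp => awFun_pos hk2 hadm hp
  have hAwK : ∀ p : ℕ, p.Prime → |1 + awFun L p - p| + (n : ℝ) ≤ ((n + 1 : ℕ) : ℝ) ^ 2 := by
    intro p hp
    have h := abs_one_add_awFun_sub_le h4 hadm hp
    linarith
  -- the hypothesis `L ≤ 29 (log X)^{1/10}` of Lemma 8.4 at the scale `R²`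
  have hΛ : ∀ i, ∀ M : ℕ, M ≠ 0 →
      (M : ℝ) ≤ (W i : ℝ) * (⌈R ^ 2⌉₊ : ℝ) ^ n → 9 + ∑ p ∈ M.primeFactors, Real.log p / p ≤ 29 * u := by
    intro i M hM hMle
    have hR'0 : 0 < R ^ 2 := by linarith
    have hN1 : 1 ≤ ⌈R ^ 2⌉₊ := Nat.one_le_iff_ne_zero.2 (Nat.ceil_pos.2 hR'0).ne'
    have hNX : ((⌈R ^ 2⌉₊ : ℕ) : ℝ) ≤ 2 * X := by
      have := Nat.ceil_lt_add_one hR'0.le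
      linarith
    refine lambda84_le_of_le_mul hk2 (Nat.le_succ n) hB0 hXone hlX1 hk2X hBX hE1 hlogE hN1 hNX hM ?_
    calc (M : ℝ) ≤ (W i : ℝ) * (⌈R ^ 2⌉₊ : ℝ) ^ n := hMle
      _ ≤ ((wCut (n + 1) B * B * E : ℕ) : ℝ) * (⌈R ^ 2⌉₊ : ℝ) ^ n :=
          mul_le_mul_of_nonneg_right (by exact_mod_cast hWi i) (by positivity)
      _ = (wCut (n + 1) B : ℝ) * B * E * (⌈R ^ 2⌉₊ : ℝ) ^ n := by push_cast; ring
  -- smallness `k ε ≤ 1` at scale `R²`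
  have huv : u * Real.log X ^ ((4 : ℝ) / 5) = Real.log X / u := by
    rw [eq_div_iff hu0.ne', hu, ← Real.rpow_add hlX0, ← Real.rpow_add hlX0]; norm_num
  have hGs₁b : 2 * (1 + 30 / MaynardDense.U (n + 1) + MaynardDense.T (n + 1)) ≤
      3 * (((n + 1 : ℕ) : ℝ) * Real.log ((n + 1 : ℕ) : ℝ)) ^ 2 * MaynardDense.gam (n + 1) := two_mul_Gs_le h18
  have hGs₂b : MaynardDense.GsMix (n + 1) ≤ 186 * (((n + 1 : ℕ) : ℝ) * Real.log ((n + 1 : ℕ) : ℝ)) ^ 2 *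
      MaynardDense.gam (n + 1) := by
    have := MaynardDense.GsMix_le hk2
    linarith
  have hGs₂0 : 0 ≤ MaynardDense.GsMix (n + 1) := le_trans (by positivity) (hM5 0 ⟨le_rfl, zero_le_one⟩)
  have hε₂b : ((n + 1 : ℕ) : ℝ) * (C84 * (29 * u) * MaynardDense.GsMix (n + 1) /
      (MaynardDense.gam (n + 1) * Real.log R)) ≤ 6960 * 186 * C84 / u :=
    keps_le_aux hC84 (by norm_num) hγ hlR0 hu0 huv hGs₂b hk3X hlogXR
  have hε₂le : C84 * (29 * u) * MaynardDense.GsMix (n + 1) / (IG₂ * Real.log (R ^ 2)) ≤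
      C84 * (29 * u) * MaynardDense.GsMix (n + 1) / (MaynardDense.gam (n + 1) * Real.log R) := by
    apply div_le_div_of_nonneg_left (by positivity) (mul_pos hγ hlR0)
    rw [hlogR2]
    have h := mul_le_mul_of_nonneg_right (show MaynardDense.gam (n + 1) ≤ 2 * IG₂ by linarith) hlR0.le
    linarith
  have hε₂0 : 0 ≤ C84 * (29 * u) * MaynardDense.GsMix (n + 1) / (IG₂ * Real.log (R ^ 2)) := by
    rw [hlogR2]; positivity
  have hsmall₂ : (n : ℝ) * (C84 * (29 * u) * MaynardDense.GsMix (n + 1) / (IG₂ * Real.log (R ^ 2))) ≤ 1 := by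
    have h1 : ((n + 1 : ℕ) : ℝ) * (C84 * (29 * u) * MaynardDense.GsMix (n + 1) /
        (MaynardDense.gam (n + 1) * Real.log R)) ≤ 1 :=
      hε₂b.trans (by rw [div_le_one hu0]; exact huCE₂)
    calc (n : ℝ) * (C84 * (29 * u) * MaynardDense.GsMix (n + 1) / (IG₂ * Real.log (R ^ 2)))
        ≤ ((n + 1 : ℕ) : ℝ) * (C84 * (29 * u) * MaynardDense.GsMix (n + 1) / (IG₂ * Real.log (R ^ 2))) :=
          mul_le_mul_of_nonneg_right hnr hε₂0
      _ ≤ ((n + 1 : ℕ) : ℝ) * (C84 * (29 * u) * MaynardDense.GsMix (n + 1) /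
            (MaynardDense.gam (n + 1) * Real.log R)) := mul_le_mul_of_nonneg_left hε₂le (by positivity)
      _ ≤ 1 := h1
  -- Lemma 8.4 for the majorant of `Σ (∫F₂ dt_m)² w` (scale `R²`, `A = A_w`, `Φ ≡ 1`, `G = mixG²`)
  obtain ⟨hPw0, hS2⟩ := h84 n W ((n + 1 : ℕ) : ℝ) (((n + 1 : ℕ) : ℝ) ^ 2) (awFun L)
    (fun t => MaynardDense.mixG (n + 1) t ^ 2) (fun _ => (1 : ℝ)) (MaynardDense.GsMix (n + 1)) IG₂ 1 0
    (29 * u) (R ^ 2) 0 hkr2 le_rfl hW0 hsm hAwp hAwK hM1 hM2g hM3 hM4 hM5 hIG₂.symm hIG₂0 contDiff_const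
    (fun x => by simp) (fun x => by simp) hRsq2 hΛ hsmall₂
  have hoi : MaynardDense.orthInt n (fun t => MaynardDense.mixG (n + 1) t ^ 2) (fun _ => (1 : ℝ)) 0 =
      IG₂ ^ n := by
    rw [MaynardDense.orthInt_one_eq_pow]
  rw [hoi] at hS2
  -- Lemma 9.3 as the approximation hypothesis of the kernel bound
  have hcM := cM_pos hadm hnd hB0 m
  have hc₀0 : 0 ≤ Real.log R * cM L B m := (mul_pos hlR0 hcM).le
  set δ : ℝ := K₂ * MaynardDense.T (n + 1) * Real.log (Real.log R) ^ 2 / Real.log R with hδ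
  have hδ0 : 0 ≤ δ := by rw [hδ]; positivity
  have hM2' : ∀ r ∈ dkBoxP L B R m,
      |yVarM L B R (MaynardDense.F (n + 1)) m r -
          Real.log R * cM L B m * margInt m (MaynardDense.F (n + 1)) (logVec R r)| ≤
        δ * (Real.log R * cM L B m) * margInt m (MaynardDense.F₂ (n + 1)) (logVec R r) := by
    intro r hr
    refine (hM2 r hr).trans (le_of_eq ?_)
    rw [hδ]; field_simp
  have hE := abs_ediffM_le_of_approx hadm hk2 hR1' m hc₀0 hδ0 hM2'
  -- the bridge to `rFoldSum` and the comparison `Π_w ≤ 4¹² Π`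
  have hbr := sum_margInt_F₂_sq_wRatio_le_rFoldSum hk2 hadm B hR1' m
  have hPw := piRec_awFun_le_M h4 hadm hnd hB0 R m
  have hMC0 : 0 ≤ mainCoeffM L B R (MaynardDense.JF (n + 1)) m :=
    mainCoeffM_nonneg hadm hnd B hR1'.le hJ0 m
  have hcx : |excProdM L m (wCut (n + 1) B * B) ⌊R⌋₊ E - 1| ≤ 1 / u :=
    hc1.trans (one_div_le_one_div_of_le hu0 hulX)
  have hk2ℓ : (MaynardDense.ell₂ (n + 1) + ((n + 1 : ℕ) : ℝ) * MaynardDense.ell (n + 1)) ^ 2 ≤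
      (2 * ((n + 1 : ℕ) : ℝ) * MaynardDense.ell (n + 1)) ^ 2 :=
    pow_le_pow_left₀ (by positivity) (ell₂_add_mul_ell_le h18) 2
  have hpow : Real.log (R ^ 2) ^ n * IG₂ ^ n ≤
      Real.log R ^ n * (Real.exp 4 * MaynardDense.gam (n + 1) ^ n) := by
    rw [hlogR2, show (2 * Real.log R) ^ n * IG₂ ^ n = Real.log R ^ n * (2 * IG₂) ^ n by
      rw [mul_pow, mul_pow]; ring]
    exact mul_le_mul_of_nonneg_left (two_mul_setIntegral_mixG_sq_pow_pred_le h18)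
      (pow_nonneg hlR0.le n)
  -- abbreviations for the final bookkeeping
  set Pr : ℝ := MaynardDense.piRec n W A with hPr
  set Pw : ℝ := MaynardDense.piRec n W (awFun L) with hPwdef
  set Sw : ℝ := ∑ r ∈ dkBoxP L B R m,
      margInt m (MaynardDense.F₂ (n + 1)) (logVec R r) ^ 2 * wRatio L (∏ i, r i) with hSwdef
  set S' : ℝ := MaynardDense.rFoldSum n W (awFun L) (fun _ => 1) (fun t => MaynardDense.mixG (n + 1) t ^ 2)
    (R ^ 2) 0 with hS'def
  set J : ℝ := MaynardDense.JF (n + 1) with hJ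
  set MC : ℝ := mainCoeffM L B R J m with hMC
  set cx : ℝ := excProdM L m (wCut (n + 1) B * B) ⌊R⌋₊ E with hcxdef
  set c₀ : ℝ := Real.log R * cM L B m with hc₀
  set γ : ℝ := MaynardDense.gam (n + 1) with hγdef
  set ℓ : ℝ := MaynardDense.ell (n + 1) with hℓdef
  set κ : ℝ := ((n + 1 : ℕ) : ℝ) with hκ
  set lR : ℝ := Real.log R with hlR
  have hid : c₀ ^ 2 * (Pr * lR ^ n * J) = MC * cx := hframe J
  have hPr0 : 0 ≤ Pr := by
    have h := hPw0.trans hPw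
    have h4pos : (0 : ℝ) < 4 ^ 12 := by positivity
    exact (mul_nonneg_iff_of_pos_left h4pos).1 h
  have hPrL0 : 0 ≤ c₀ ^ 2 * (Pr * lR ^ n) :=
    mul_nonneg (sq_nonneg _) (mul_nonneg hPr0 (pow_nonneg hlR0.le n))
  -- `S' ≤ 3 Π_w log(R²)^n IG₂^n ≤ 3·4¹² Π (log R)^n e⁴ γ^n`
  have hS2' : S' ≤ 3 * (Pw * Real.log (R ^ 2) ^ n * IG₂ ^ n) := by
    have h0 : 0 ≤ Pw * Real.log (R ^ 2) ^ n * IG₂ ^ n :=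
      mul_nonneg (mul_nonneg hPw0 (pow_nonneg (by rw [hlogR2]; positivity) n)) (pow_nonneg hIG₂0.le n)
    have h1 := (abs_sub_le_iff.1 hS2).1
    have h2 : (n : ℝ) * (C84 * (29 * u) * MaynardDense.GsMix (n + 1) / (IG₂ * Real.log (R ^ 2))) *
        (Pw * Real.log (R ^ 2) ^ n * IG₂ ^ n) ≤ 1 * (Pw * Real.log (R ^ 2) ^ n * IG₂ ^ n) :=
      mul_le_mul_of_nonneg_right hsmall₂ h0
    linarith
  have hS2'' : S' ≤ 3 * ((4 : ℝ) ^ 12 * Pr * (lR ^ n * (Real.exp 4 * γ ^ n))) := by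
    have h1 : Pw * Real.log (R ^ 2) ^ n * IG₂ ^ n ≤ ((4 : ℝ) ^ 12 * Pr) * (lR ^ n * (Real.exp 4 * γ ^ n)) := by
      rw [mul_assoc]
      exact mul_le_mul hPw hpow (mul_nonneg (pow_nonneg (by rw [hlogR2]; positivity) n)
        (pow_nonneg hIG₂0.le n)) (by positivity)
    linarith
  -- `c₀² S_w ≤ 24·4¹²·e⁴ κ² · MC·cx`
  have hSw : c₀ ^ 2 * Sw ≤ 24 * 4 ^ 12 * Real.exp 4 * κ ^ 2 * (MC * cx) := by
    rw [← hid]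
    have h3 : 0 ≤ 3 * ((4 : ℝ) ^ 12 * Pr * (lR ^ n * (Real.exp 4 * γ ^ n))) := by positivity
    calc c₀ ^ 2 * Sw
        ≤ c₀ ^ 2 * ((2 * κ * ℓ) ^ 2 * (3 * ((4 : ℝ) ^ 12 * Pr * (lR ^ n * (Real.exp 4 * γ ^ n))))) := by
          refine mul_le_mul_of_nonneg_left (hbr.trans ?_) (sq_nonneg _)
          exact (mul_le_mul_of_nonneg_left hS2'' (sq_nonneg _)).trans
            (mul_le_mul_of_nonneg_right hk2ℓ h3)
      _ = 12 * 4 ^ 12 * Real.exp 4 * κ ^ 2 * (c₀ ^ 2 * (Pr * lR ^ n) * (ℓ ^ 2 * γ ^ n)) := by ring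
      _ ≤ 12 * 4 ^ 12 * Real.exp 4 * κ ^ 2 * (c₀ ^ 2 * (Pr * lR ^ n) * (2 * J)) :=
          mul_le_mul_of_nonneg_left (mul_le_mul_of_nonneg_left hJ2 hPrL0) (by positivity)
      _ = 24 * 4 ^ 12 * Real.exp 4 * κ ^ 2 * (c₀ ^ 2 * (Pr * lR ^ n * J)) := by ring
  have hSw0 : 0 ≤ c₀ ^ 2 * Sw :=
    mul_nonneg (sq_nonneg _) (Finset.sum_nonneg fun r _ =>
      mul_nonneg (sq_nonneg _) (wRatio_nonneg (le_trans (by norm_num) hk2) L _))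
  -- `δ κ² ≤ 24000 K₂/u`, `κ² T/log R ≤ 60/u`, `C_s ≤ 3T`
  have hδκ : δ * κ ^ 2 ≤ 24000 * K₂ / u := by
    have e : δ * κ ^ 2 = K₂ * (κ ^ 2 * MaynardDense.T (n + 1) * Real.log lR ^ 2 / lR) := by
      rw [hδ]; ring
    rw [e]
    calc K₂ * (κ ^ 2 * MaynardDense.T (n + 1) * Real.log lR ^ 2 / lR) ≤ K₂ * (24000 / u) :=
          mul_le_mul_of_nonneg_left hgrowth hK₂.le
      _ = 24000 * K₂ / u := by ring
  have hCs : 30 + 30 / MaynardDense.U (n + 1) + MaynardDense.T (n + 1) ≤ 3 * MaynardDense.T (n + 1) :=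
    MaynardDense.shift_const_le h18
  have hCs0 : 0 ≤ 30 + 30 / MaynardDense.U (n + 1) + MaynardDense.T (n + 1) := by
    have hU : 0 < MaynardDense.U (n + 1) := by unfold MaynardDense.U; positivity
    positivity
  exact ediff_final_combination hMC0 hu1 hcx hkr1 hδ0 hTk.le hlR0 hCs0 hCs (by positivity) hK₂.le hSw0
    hE hSw hgrowth' hδκ

/-- **Leaf M3 holds**: `E_diff^{(m)} ≪ (log X)^{−1/10} · main term` (Lemma 9.3 is proved in the tree).
[cite: Maynard2016DenseClusters, proof of Prop. 9.2 p. 22, (9.16)–(9.18); Lemma 9.3] -/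
theorem maynard2016Prop92EDiffBound_holds : Maynard2016Prop92EDiffBound :=
  maynard2016Prop92EDiffBound_of_lemma93Z maynard2016Lemma93Z_holds

/-- **Leaf M4 holds**: `Σ' (y^{(m)}_r)²/φ_ω(r) = (1 + O((log X)^{−1/10})) · main term` (Lemma 9.3 is proved in the tree).
[cite: Maynard2016DenseClusters, proof of Prop. 9.2 pp. 22–23, (9.19)–(9.21); Lemma 9.3] -/
theorem maynard2016Prop92YSqSum_holds : Maynard2016Prop92YSqSum :=
  maynard2016Prop92YSqSum_of_lemma93Z maynard2016Lemma93Z_holds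

/-- **Maynard 2016, Proposition 9.2 for `𝒜 = ℤ` in the frame of FGKMT's Proposition 6.1 / Theorem 6 (7.13)** —
the DAG leaf `Maynard2016DenseClusters_prop92Z`: for some absolute `C, K`, eventually in `x`, uniformly in the
ranges of Prop. 6.1, for `k ≥ C` and every `m` with `L_m(n) > R` on the support,
`Σ_n 𝟙_{L_m(n) prime} w_n = (1 + O((log X)^{−1/10})) · (B/φ(B))^{k−1} 𝔖_B(𝓛) #𝒫_{L_m}(x) (log R)^{k+1} J_k + O(errors)`,
assembled from the error half (Lemma 8.1 / (9.7), `maynard2016Prop92ErrorPart_holds`) and the main half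
(M1 regrouping, M3 `E_diff`, M4 the `y^{(m)}`-square sum, via `maynard2016Prop92MainPart_of_leaves`).
[cite: Maynard2016DenseClusters, Prop. 9.2 pp. 21–23 with Lemmas 8.1–8.6, 9.3;
FordGreenKonyaginMaynardTao2018, Thm 6 (7.13) pp. 21–23] -/
theorem maynard2016DenseClusters_prop92Z_holds : Maynard2016DenseClusters_prop92Z :=
  maynard2016_prop92Z_of_parts maynard2016Prop92ErrorPart_holds
    (maynard2016Prop92MainPart_of_leaves maynard2016Prop92Regroup_holds maynard2016Prop92EDiffBound_holds
      maynard2016Prop92YSqSum_holds)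

end Literature.NumberTheory.Sieve
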